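import Summits.AtomisticToContinuum.HydrodynamicLimit.Theorems.JParityClosureLocalSecondLawComposition

/-!
# The line's reductions and six-input bridge transported to the PRE-SHOCK frame (C′)
(stmt-AtomisticToContinuum-13081, line `exact-entropy-ledger-three-passivities`, continuation lead c5)

Companion of `…CompositionPreShock.lean` (`localSecondLawInBand_of_passivities_preShock : F′ → P1′ → P2′ → P3′ →
LocalSecondLawInBand`).  The landed reductions of the three passivities to the line's typed closure inputs
(`passivityKinetic_of_isotropy`, `weightedKineticPassivity_of_isotropy` / `passivityCollisional_of_enskog`,
`passivityThermal_of_closure`, `strain_of_coarseBounds`, `thermalStrain_of_coarseBounds`) are stated in the filed all-`τ`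
frame; their deterministic cores (`psvK_abs_T₁_le`, `setOf_T₂_lt_subset` + `collisionalWorkIntegrable_holds`,
`psvT_abs_T₃kin_le`, `strainBound_of_coarseBounds`, `thermalStrainBound_of_coarseBounds`) are PATHWISE, so each reduction
holds verbatim with the single extra hypothesis `τ < T` threaded through inputs and conclusion.  This file records these
pre-shock twins (proofs = the landed proofs with `hτT` threaded; no new mathematics); the two compositions over them,
`localSecondLawInBand_of_inputs_preShock` and `localSecondLawInBand_of_sixInputs_preShock` (conclusion
`C′ = LocalSecondLawInBand` of `Cruxes/LocalSecondLaw/Restatement.lean` verbatim), are in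
`…CompositionSixPreShock.lean`.  Primed inputs: the registered/landed all-`τ` texts with `τ < T →` inserted after `0 < τ →`
(F′ moreover with the guard `(∀ t ∈ Ico 0 T, ∀ x, ρ t x * σ ^ 3 < ηg)` at a level `0 < ηg < η₁`).  Under the restatement
asked for in `Cruxes/LocalSecondLaw/VERDICT-c4.md` these six pre-shock statements are the crux's honest residue, each with a
pre-shock producer on the board (DensityCap 13082 + guard and a floors item; OddContactSymmetry 17722 + RateFloor 13080 +
ParityRigidity/ParitySplit/EmpiricalEnskogIdentity + CollisionTightness 13085 + KineticEnergyTails 13087 for Iso′;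
EvenStressEnskog 13079 + a finite-net step for W′; a cubic-closure item for Cubic′; the energy-transfer mark + net for
CollisionalHeat′).  Nothing here closes the filed all-`τ` item.

References: H. Spohn, *Large Scale Dynamics of Interacting Particles* (1991), Part I §3; E. Feireisl, A. Novotný,
*Singular Limits in Thermodynamics of Viscous Fluids* (2009/2017), §2.
-/

noncomputable section

namespace Summit.AtomisticToContinuum.HydrodynamicLimit.Theorems.LocalSecondLawLedger

open scoped BigOperators Topology ENNReal InnerProductSpace
open Filter Set MeasureTheory
open Literature.MathematicalPhysics.KineticTheory
open Literature.Analysis.FluidPDE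
open Summit.AtomisticToContinuum.HydrodynamicLimit.Theses
open Summit.AtomisticToContinuum.HydrodynamicLimit.Theorems.LocalSecondLawNegative

variable {N : ℕ}

/-- **Strain tightness from coarse bounds at the doubled radius, pre-shock frame** (`τ < T` threaded through the landed `strain_of_coarseBounds`; same constant `K = 32(D + 2E)(1/c + 8D/c²)`, same deterministic core `strainBound_of_coarseBounds`). -/
theorem strain_of_coarseBounds_preShock :
  (∀ (a₀ θ₀ : T3 → ℝ) (u₀ : T3 → V3), Continuous a₀ → Continuous θ₀ → Continuous u₀ → (∀ x, 0 < a₀ x) → (∀ x, 0 < θ₀ x) → ∃ σ₀ : ℝ, 0 < σ₀ ∧ ∀ σ : ℝ, 0 < σ → σ < σ₀ → ∀ (T : ℝ) (ρ θ : ℝ → T3 → ℝ) (u : ℝ → T3 → V3), IsHardSphereEulerSolution σ T ρ u θ → ∀ Φ : (N : ℕ) → Flow σ N, TendstoHydroFieldsAt (fun N => localGibbsLaw σ a₀ u₀ θ₀ N (Φ N)) Φ ρ u θ 0 → 0 < T → ∀ τ : ℝ, 0 < τ → τ < T → ∀ c η₁ : ℝ, 0 < c → ∀ δ : ℝ, 0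 < δ → ∃ D : ℝ, 0 < D ∧ ∃ E : ℝ, 0 < E ∧ ∃ r₀ : ℝ, 0 < r₀ ∧ ∀ r : ℝ, 0 < r → r < r₀ → ∃ N₀ : ℕ, ∀ N : ℕ, N₀ ≤ N → localGibbsLaw σ a₀ u₀ θ₀ N (Φ N) {z | Regular σ r τ c η₁ (Φ N) z ∧ ∃ s ∈ Set.Icc (0 : ℝ) τ, ∃ x : T3, D < rhoC (2 * r) ((Φ N).flow s z) x ∨ E < kinC (2 * r) ((Φ N).flow s z) x} ≤ ENNReal.ofReal δ) → ∀ (a₀ θ₀ : T3 → ℝ) (u₀ : T3 → V3), Continuous a₀ → Continuous θ₀ → Continuous u₀ → (∀ x, 0 < a₀ x) → (∀ x, 0 < θ₀ x) → ∃ σ₀ : ℝ, 0 < σ₀ ∧ ∀ σ : ℝ, 0 < σ → σ < σ₀ → ∀ (T : ℝ) (ρ θ : ℝ → T3 → ℝ) (u : ℝ → T3 → V3), IsHardSphereEulerSolution σ T ρ u θ → ∀ Φ : (N : ℕ) → Flow σ N, TendstoHydroFieldsAt (fun N => localGibbsLaw σ a₀ u₀ θ₀ N (Φ N)) Φ ρ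 u θ 0 → 0 < T → ∀ τ : ℝ, 0 < τ → τ < T → ∀ c η₁ : ℝ, 0 < c → ∀ δ : ℝ, 0 < δ → ∃ K : ℝ, 0 < K ∧ ∃ r₀ : ℝ, 0 < r₀ ∧ ∀ r : ℝ, 0 < r → r < r₀ → ∃ N₀ : ℕ, ∀ N : ℕ, N₀ ≤ N → localGibbsLaw σ a₀ u₀ θ₀ N (Φ N) {z | Regular σ r τ c η₁ (Φ N) z ∧ ∃ s ∈ Set.Icc (0 : ℝ) τ, ∃ x : T3, ∃ k l : Fin 3, K < r * |pD k (fun y => uC r ((Φ N).flow s z) y l) x|} ≤ ENNReal.ofReal δ := by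
  intro hCB a₀ θ₀ u₀ ha hθ hu ha0 hθ0
  obtain ⟨σ₀, hσ₀, H⟩ := hCB a₀ θ₀ u₀ ha hθ hu ha0 hθ0
  refine ⟨σ₀, hσ₀, fun σ hσ hσlt T ρ θ u hsol Φ h0 hT τ hτ hτT c η₁ hc δ hδ => ?_⟩
  obtain ⟨D, hD, E, hE, r₀, hr₀, H'⟩ := H σ hσ hσlt T ρ θ u hsol Φ h0 hT τ hτ hτT c η₁ hc δ hδ
  refine ⟨32 * (D + 2 * E) * (1 / c + 8 * D / c ^ 2), by positivity, r₀, hr₀, fun r hr hrr => ?_⟩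
  obtain ⟨N₀, HN⟩ := H' r hr hrr
  refine ⟨N₀, fun N hN => le_trans (measure_mono ?_) (HN N hN)⟩
  rintro z ⟨hReg, s, hs, x, k, l, hK⟩
  refine ⟨hReg, ?_⟩
  by_contra hcon
  push Not at hcon
  exact absurd (strainBound_of_coarseBounds hr hc hReg hcon s hs x k l) (not_le.2 hK)

/-- **Thermal-strain tightness from coarse bounds at the doubled radius, pre-shock frame** (`τ < T` threaded through the landed `thermalStrain_of_coarseBounds`; core `thermalStrainBound_of_coarseBounds`). -/
theorem thermalStrain_of_coarseBounds_preShock :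
  (∀ (a₀ θ₀ : T3 → ℝ) (u₀ : T3 → V3), Continuous a₀ → Continuous θ₀ → Continuous u₀ → (∀ x, 0 < a₀ x) → (∀ x, 0 < θ₀ x) → ∃ σ₀ : ℝ, 0 < σ₀ ∧ ∀ σ : ℝ, 0 < σ → σ < σ₀ → ∀ (T : ℝ) (ρ θ : ℝ → T3 → ℝ) (u : ℝ → T3 → V3), IsHardSphereEulerSolution σ T ρ u θ → ∀ Φ : (N : ℕ) → Flow σ N, TendstoHydroFieldsAt (fun N => localGibbsLaw σ a₀ u₀ θ₀ N (Φ N)) Φ ρ u θ 0 → 0 < T → ∀ τ : ℝ, 0 < τ → τ < T → ∀ c η₁ : ℝ, 0 < c → ∀ δ : ℝ, 0 < δ → ∃ D : ℝ, 0 < D ∧ ∃ E : ℝ, 0 < E ∧ ∃ r₀ : ℝ, 0 < r₀ ∧ ∀ r : ℝ, 0 < r → r < r₀ → ∃ N₀ : ℕ, ∀ N : ℕ, N₀ ≤ N → localGibbsLaw σ a₀ u₀ θ₀ N (Φ N) {z | Regular σ r τ c η₁ (Φ N) z ∧ ∃ s ∈ Set.Icc (0 : ℝ) τ, ∃ x :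 T3, D < rhoC (2 * r) ((Φ N).flow s z) x ∨ E < kinC (2 * r) ((Φ N).flow s z) x} ≤ ENNReal.ofReal δ) → ∀ (a₀ θ₀ : T3 → ℝ) (u₀ : T3 → V3), Continuous a₀ → Continuous θ₀ → Continuous u₀ → (∀ x, 0 < a₀ x) → (∀ x, 0 < θ₀ x) → ∃ σ₀ : ℝ, 0 < σ₀ ∧ ∀ σ : ℝ, 0 < σ → σ < σ₀ → ∀ (T : ℝ) (ρ θ : ℝ → T3 → ℝ) (u : ℝ → T3 → V3), IsHardSphereEulerSolution σ T ρ u θ → ∀ Φ : (N : ℕ) → Flow σ N, TendstoHydroFieldsAt (fun N => localGibbsLaw σ a₀ u₀ θ₀ N (Φ N)) Φ ρ u θ 0 → 0 < T → ∀ τ : ℝ, 0 < τ → τ < T → ∀ c η₁ : ℝ, 0 < c → ∀ δ : ℝ, 0 < δ → ∃ K : ℝ, 0 < K ∧ ∃ r₀ : ℝ, 0 < r₀ ∧ ∀ r : ℝ, 0 < r → r < r₀ → ∃ N₀ : ℕ, ∀ N : ℕ, N₀ ≤ N → localGibbsLaw σ a₀ u₀ θ₀ N (Φ N) {z | Regular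 σ r τ c η₁ (Φ N) z ∧ ∃ s ∈ Set.Icc (0 : ℝ) τ, ∃ x : T3, ∃ k : Fin 3, K < r * |pD k (fun y => thetaC r ((Φ N).flow s z) y) x|} ≤ ENNReal.ofReal δ := by
  intro hCB a₀ θ₀ u₀ ha hθ hu ha0 hθ0
  obtain ⟨σ₀, hσ₀, H⟩ := hCB a₀ θ₀ u₀ ha hθ hu ha0 hθ0
  refine ⟨σ₀, hσ₀, fun σ hσ hσlt T ρ θ u hsol Φ h0 hT τ hτ hτT c η₁ hc δ hδ => ?_⟩
  obtain ⟨D, hD, E, hE, r₀, hr₀, H'⟩ := H σ hσ hσlt T ρ θ u hsol Φ h0 hT τ hτ hτT c η₁ hc δ hδ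
  refine ⟨2 / 3 * (64 * E / c + 8 * E * (64 * D) / c ^ 2 +
    32 * (D + 2 * E) * (1 / c + 8 * D / c ^ 2) * ((4 * D + 8 * E) / c)), by positivity, r₀, hr₀, fun r hr hrr => ?_⟩
  obtain ⟨N₀, HN⟩ := H' r hr hrr
  refine ⟨N₀, fun N hN => le_trans (measure_mono ?_) (HN N hN)⟩
  rintro z ⟨hReg, s, hs, x, k, hK⟩
  refine ⟨hReg, ?_⟩
  by_contra hcon
  push Not at hcon
  exact absurd (thermalStrainBound_of_coarseBounds hr hc hReg hcon s hs x k) (not_le.2 hK)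

/-- **P1′ from Iso′ and Strain′** — the pre-shock twin of the landed `passivityKinetic_of_isotropy`: kinetic `L¹`-isotropy at rate `r` and strain tightness at rate `1/r`, both asserted only for horizons `τ < T`, give the pre-shock kinetic passivity `P(Regular ∧ T₁ < −η) ≤ δ` (`τ < T`).  Same thresholds and the same deterministic core `psvK_abs_T₁_le`; only the extra hypothesis `τ < T` is threaded. -/
theorem passivityKinetic_of_isotropy_preShock :
  (∀ (a₀ θ₀ : T3 → ℝ) (u₀ : T3 → V3), Continuous a₀ → Continuous θ₀ → Continuous u₀ → (∀ x, 0 < a₀ x) → (∀ x, 0 < θ₀ x) → ∃ σ₀ : ℝ, 0 < σ₀ ∧ ∀ σ : ℝ, 0 < σ → σ < σ₀ → ∀ (T : ℝ) (ρ θ : ℝ → T3 → ℝ) (u : ℝ → T3 → V3), IsHardSphereEulerSolution σ T ρ u θ → ∀ Φ : (N : ℕ) → Flow σ N, TendstoHydroFieldsAt (fun N => localGibbsLaw σ a₀ u₀ θ₀ N (Φ N)) Φ ρ u θ 0 → 0 < T → ∀ τ : ℝ, 0 < τ → τ < T → ∀ c η₁ : ℝ, 0 < c → ∀ η δ : ℝ,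 0 < η → 0 < δ → ∃ r₀ : ℝ, 0 < r₀ ∧ ∀ r : ℝ, 0 < r → r < r₀ → ∃ N₀ : ℕ, ∀ N : ℕ, N₀ ≤ N → localGibbsLaw σ a₀ u₀ θ₀ N (Φ N) {z | Regular σ r τ c η₁ (Φ N) z ∧ η * r < ∫ s in Set.Icc (0 : ℝ) τ, ∫ x : T3, ∑ k : Fin 3, ∑ l : Fin 3, |devC r ((Φ N).flow s z) x k l|} ≤ ENNReal.ofReal δ) → (∀ (a₀ θ₀ : T3 → ℝ) (u₀ : T3 → V3), Continuous a₀ → Continuous θ₀ → Continuous u₀ → (∀ x, 0 < a₀ x) → (∀ x, 0 < θ₀ x) → ∃ σ₀ : ℝ, 0 < σ₀ ∧ ∀ σ : ℝ, 0 < σ → σ < σ₀ → ∀ (T : ℝ) (ρ θ : ℝ → T3 → ℝ) (u : ℝ → T3 → V3), IsHardSphereEulerSolution σ T ρ u θ → ∀ Φ : (N : ℕ) → Flow σ N, TendstoHydroFieldsAt (fun N => localGibbsLaw σ a₀ u₀ θ₀ N (Φ N)) Φ ρ u θ 0 → 0 < T → ∀ τ : ℝ, 0 < τ → τ < T → ∀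 c η₁ : ℝ, 0 < c → ∀ δ : ℝ, 0 < δ → ∃ K : ℝ, 0 < K ∧ ∃ r₀ : ℝ, 0 < r₀ ∧ ∀ r : ℝ, 0 < r → r < r₀ → ∃ N₀ : ℕ, ∀ N : ℕ, N₀ ≤ N → localGibbsLaw σ a₀ u₀ θ₀ N (Φ N) {z | Regular σ r τ c η₁ (Φ N) z ∧ ∃ s ∈ Set.Icc (0 : ℝ) τ, ∃ x : T3, ∃ k l : Fin 3, K < r * |pD k (fun y => uC r ((Φ N).flow s z) y l) x|} ≤ ENNReal.ofReal δ) → ∀ (a₀ θ₀ : T3 → ℝ) (u₀ : T3 → V3), Continuous a₀ → Continuous θ₀ → Continuous u₀ → (∀ x, 0 < a₀ x) → (∀ x, 0 < θ₀ x) → ∃ σ₀ : ℝ, 0 < σ₀ ∧ ∀ σ : ℝ, 0 < σ → σ < σ₀ → ∀ (T : ℝ) (ρ θ : ℝ → T3 → ℝ) (u : ℝ → T3 → V3), IsHardSphereEulerSolution σ T ρ u θ → ∀ Φ : (N : ℕ) → Flow σ N, TendstoHydroFieldsAt (fun N => localGibbsLaw σ a₀ u₀ θ₀ N (Φ N)) Φ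 ρ u θ 0 → 0 < T → ∀ τ : ℝ, 0 < τ → τ < T → ∀ φ : ℝ → T3 → ℝ, Literature.Analysis.FunctionSpaces.Torus.IsSmoothSpaceTimeOn Set.univ φ → (∀ s x, 0 ≤ φ s x) → (∃ τ' : ℝ, τ' < τ ∧ ∀ s, τ' ≤ s → ∀ x, φ s x = 0) → ∀ c η₁ : ℝ, 0 < c → ∀ η δ : ℝ, 0 < η → 0 < δ → ∃ r₀ : ℝ, 0 < r₀ ∧ ∀ r : ℝ, 0 < r → r < r₀ → ∃ N₀ : ℕ, ∀ N : ℕ, N₀ ≤ N → localGibbsLaw σ a₀ u₀ θ₀ N (Φ N) {z | Regular σ r τ c η₁ (Φ N) z ∧ T₁ σ r τ φ (Φ N) z < -η} ≤ ENNReal.ofReal δ := by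
  intro hIso hStr a₀ θ₀ u₀ ha hθ hu ha0 hθ0
  obtain ⟨σ₁, hσ₁, H1⟩ := hIso a₀ θ₀ u₀ ha hθ hu ha0 hθ0
  obtain ⟨σ₂, hσ₂, H2⟩ := hStr a₀ θ₀ u₀ ha hθ hu ha0 hθ0
  refine ⟨min σ₁ σ₂, lt_min hσ₁ hσ₂, ?_⟩
  intro σ hσ hσlt T ρ θ u hE Φ h0 hT τ hτ hτT φ hφ _hφ0 _hsupp c η₁ hc η δ hη hδ
  have hσ1 : σ < σ₁ := lt_of_lt_of_le hσlt (min_le_left _ _)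
  have hσ2 : σ < σ₂ := lt_of_lt_of_le hσlt (min_le_right _ _)
  have hδ2 : 0 < δ / 2 := by positivity
  -- the weight bound `M + 1 > 0` on `[0,τ] × 𝕋³`
  obtain ⟨M₀, hM₀⟩ := hφ.exists_norm_le_of_isCompact isCompact_Icc (Set.subset_univ (Set.Icc (0 : ℝ) τ))
  set M : ℝ := max M₀ 0 with hMdef
  have hM0 : 0 ≤ M := le_max_right _ _
  have hM : ∀ s ∈ Set.Icc (0 : ℝ) τ, ∀ x, |φ s x| ≤ M := fun s hs x => by
    rw [← Real.norm_eq_abs]; exact (hM₀ s hs x).trans (le_max_left _ _)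
  -- strain tightness at `δ/2`
  obtain ⟨K, hK, r₂, hr₂, H2'⟩ := H2 σ hσ hσ2 T ρ θ u hE Φ h0 hT τ hτ hτT c η₁ hc (δ / 2) hδ2
  -- isotropy at level `η c / ((M + 1) K)`, `δ/2`
  have hη' : 0 < η * c / ((M + 1) * K) := by positivity
  obtain ⟨r₁, hr₁, H1'⟩ :=
    H1 σ hσ hσ1 T ρ θ u hE Φ h0 hT τ hτ hτT c η₁ hc (η * c / ((M + 1) * K)) (δ / 2) hη' hδ2
  refine ⟨min r₁ r₂, lt_min hr₁ hr₂, ?_⟩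
  intro r hr hrlt
  have hr1 : r < r₁ := lt_of_lt_of_le hrlt (min_le_left _ _)
  have hr2 : r < r₂ := lt_of_lt_of_le hrlt (min_le_right _ _)
  obtain ⟨N₁, HN1⟩ := H1' r hr hr1
  obtain ⟨N₂, HN2⟩ := H2' r hr hr2
  refine ⟨max N₁ N₂, fun N hN => ?_⟩
  have E1 := HN1 N ((le_max_left _ _).trans hN)
  have E2 := HN2 N ((le_max_right _ _).trans hN)
  -- event inclusion: off both exceptional events the deterministic core gives `T₁ ≥ -η`
  have hsub : {z | Regular σ r τ c η₁ (Φ N) z ∧ T₁ σ r τ φ (Φ N) z < -η} ⊆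
      {z | Regular σ r τ c η₁ (Φ N) z ∧
          η * c / ((M + 1) * K) * r < ∫ s in Set.Icc (0 : ℝ) τ, ∫ x : T3,
            ∑ k : Fin 3, ∑ l : Fin 3, |devC r ((Φ N).flow s z) x k l|} ∪
        {z | Regular σ r τ c η₁ (Φ N) z ∧
          ∃ s ∈ Set.Icc (0 : ℝ) τ, ∃ x : T3, ∃ k l : Fin 3,
            K < r * |pD k (fun y => uC r ((Φ N).flow s z) y l) x|} := by
    rintro z ⟨hReg, hT⟩
    by_contra hcon
    simp only [Set.mem_union, Set.mem_setOf_eq, not_or, not_and, not_lt, not_exists] at hcon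
    obtain ⟨hA, hB⟩ := hcon
    have hA' := hA hReg
    have hB' : ∀ s ∈ Set.Icc (0 : ℝ) τ, ∀ x, ∀ k l : Fin 3,
        r * |pD k (fun y => uC r ((Φ N).flow s z) y l) x| ≤ K := fun s hs x k l => hB hReg s hs x k l
    have hcore := psvK_abs_T₁_le hr hc hτ.le hReg hM hB'
    have hI0 : 0 ≤ ∫ s in Set.Icc (0 : ℝ) τ, ∫ x : T3,
        ∑ k : Fin 3, ∑ l : Fin 3, |devC r ((Φ N).flow s z) x k l| :=
      setIntegral_nonneg measurableSet_Icc fun s _ =>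
        integral_nonneg fun x => Finset.sum_nonneg fun k _ => Finset.sum_nonneg fun l _ => abs_nonneg _
    have hW : 0 ≤ M * K / (c * r) := by positivity
    have h1 : |T₁ σ r τ φ (Φ N) z| ≤ M * K / (c * r) * (η * c / ((M + 1) * K) * r) :=
      hcore.trans (mul_le_mul_of_nonneg_left hA' hW)
    have h2 : M * K / (c * r) * (η * c / ((M + 1) * K) * r) = η * (M / (M + 1)) := by
      field_simp
    have h3 : η * (M / (M + 1)) < η := by
      have : M / (M + 1) < 1 := by rw [div_lt_one (by positivity)]; linarith
      nlinarith
    have h4 : -η < T₁ σ r τ φ (Φ N) z := by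
      have := neg_abs_le (T₁ σ r τ φ (Φ N) z)
      linarith
    linarith
  calc localGibbsLaw σ a₀ u₀ θ₀ N (Φ N) {z | Regular σ r τ c η₁ (Φ N) z ∧ T₁ σ r τ φ (Φ N) z < -η}
      ≤ localGibbsLaw σ a₀ u₀ θ₀ N (Φ N)
          ({z | Regular σ r τ c η₁ (Φ N) z ∧
              η * c / ((M + 1) * K) * r < ∫ s in Set.Icc (0 : ℝ) τ, ∫ x : T3,
                ∑ k : Fin 3, ∑ l : Fin 3, |devC r ((Φ N).flow s z) x k l|} ∪
            {z | Regular σ r τ c η₁ (Φ N) z ∧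
              ∃ s ∈ Set.Icc (0 : ℝ) τ, ∃ x : T3, ∃ k l : Fin 3,
                K < r * |pD k (fun y => uC r ((Φ N).flow s z) y l) x|}) := measure_mono hsub
    _ ≤ _ := measure_union_le _ _
    _ ≤ ENNReal.ofReal (δ / 2) + ENNReal.ofReal (δ / 2) := add_le_add E1 E2
    _ = ENNReal.ofReal δ := by rw [← ENNReal.ofReal_add hδ2.le hδ2.le, add_halves]


/-- **The `(Z−1)`-weighted kinetic passivity, pre-shock frame, from Iso′ and Strain′** — twin of the landed `weightedKineticPassivity_of_isotropy` (conclusion = the text of `WeightedKineticPassivity` with `τ < T →` inserted after `0 < τ →`, inlined; core `psvK_abs_T₁_le` with the bounded weight `φ·(2/5)(Z−1)`, `EosBand.exists_bound`). -/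
theorem weightedKineticPassivity_of_isotropy_preShock :
  (∀ (a₀ θ₀ : T3 → ℝ) (u₀ : T3 → V3), Continuous a₀ → Continuous θ₀ → Continuous u₀ → (∀ x, 0 < a₀ x) → (∀ x, 0 < θ₀ x) → ∃ σ₀ : ℝ, 0 < σ₀ ∧ ∀ σ : ℝ, 0 < σ → σ < σ₀ → ∀ (T : ℝ) (ρ θ : ℝ → T3 → ℝ) (u : ℝ → T3 → V3), IsHardSphereEulerSolution σ T ρ u θ → ∀ Φ : (N : ℕ) → Flow σ N, TendstoHydroFieldsAt (fun N => localGibbsLaw σ a₀ u₀ θ₀ N (Φ N)) Φ ρ u θ 0 → 0 < T → ∀ τ : ℝ, 0 < τ → τ < T → ∀ c η₁ : ℝ, 0 < c → ∀ η δ : ℝ, 0 < η → 0 < δ → ∃ r₀ : ℝ, 0 < r₀ ∧ ∀ r : ℝ, 0 < r → r < r₀ → ∃ N₀ : ℕ, ∀ N : ℕ, N₀ ≤ N → localGibbsLaw σ a₀ u₀ θ₀ N (Φ N) {z | Regular σ r τ c η₁ (Φ N) z ∧ η * r < ∫ s in Set.Icc (0 : ℝ) τ, ∫ x : T3, ∑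 k : Fin 3, ∑ l : Fin 3, |devC r ((Φ N).flow s z) x k l|} ≤ ENNReal.ofReal δ) → (∀ (a₀ θ₀ : T3 → ℝ) (u₀ : T3 → V3), Continuous a₀ → Continuous θ₀ → Continuous u₀ → (∀ x, 0 < a₀ x) → (∀ x, 0 < θ₀ x) → ∃ σ₀ : ℝ, 0 < σ₀ ∧ ∀ σ : ℝ, 0 < σ → σ < σ₀ → ∀ (T : ℝ) (ρ θ : ℝ → T3 → ℝ) (u : ℝ → T3 → V3), IsHardSphereEulerSolution σ T ρ u θ → ∀ Φ : (N : ℕ) → Flow σ N, TendstoHydroFieldsAt (fun N => localGibbsLaw σ a₀ u₀ θ₀ N (Φ N)) Φ ρ u θ 0 → 0 < T → ∀ τ : ℝ, 0 < τ → τ < T → ∀ c η₁ : ℝ, 0 < c → ∀ δ : ℝ, 0 < δ → ∃ K : ℝ, 0 < K ∧ ∃ r₀ : ℝ, 0 < r₀ ∧ ∀ r : ℝ, 0 < r → r < r₀ → ∃ N₀ : ℕ, ∀ N : ℕ, N₀ ≤ N → localGibbsLaw σ a₀ u₀ θ₀ N (Φ N) {z | Regular σ r τ c η₁ (Φ N)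 z ∧ ∃ s ∈ Set.Icc (0 : ℝ) τ, ∃ x : T3, ∃ k l : Fin 3, K < r * |pD k (fun y => uC r ((Φ N).flow s z) y l) x|} ≤ ENNReal.ofReal δ) → (∀ (η₀ : ℝ) (F : ℝ → ℝ), EosBand η₀ F → ∀ η₁ : ℝ, 0 < η₁ → η₁ < η₀ → ∀ (a₀ θ₀ : T3 → ℝ) (u₀ : T3 → V3), Continuous a₀ → Continuous θ₀ → Continuous u₀ → (∀ x, 0 < a₀ x) → (∀ x, 0 < θ₀ x) → ∃ σ₀ : ℝ, 0 < σ₀ ∧ ∀ σ : ℝ, 0 < σ → σ < σ₀ → ∀ (T : ℝ) (ρ θ : ℝ → T3 → ℝ) (u : ℝ → T3 → V3), IsHardSphereEulerSolution σ T ρ u θ → ∀ Φ : (N : ℕ) → Flow σ N, TendstoHydroFieldsAt (fun N => localGibbsLaw σ a₀ u₀ θ₀ N (Φ N)) Φ ρ u θ 0 → 0 < T → ∀ τ : ℝ, 0 < τ → τ < T → ∀ φ : ℝ → T3 → ℝ, Literature.Analysis.FunctionSpaces.Torus.IsSmoothSpaceTimeOn Set.univ φ → (∀ s x, 0 ≤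 φ s x) → (∃ τ' : ℝ, τ' < τ ∧ ∀ s, τ' ≤ s → ∀ x, φ s x = 0) → ∀ c : ℝ, 0 < c → ∀ η δ : ℝ, 0 < η → 0 < δ → ∃ r₀ : ℝ, 0 < r₀ ∧ ∀ r : ℝ, 0 < r → r < r₀ → ∃ N₀ : ℕ, ∀ N : ℕ, N₀ ≤ N → localGibbsLaw σ a₀ u₀ θ₀ N (Φ N) {z | Regular σ r τ c η₁ (Φ N) z ∧ T₁weighted σ r τ φ (Φ N) z < -η} ≤ ENNReal.ofReal δ) := by
  intro hIso hStr η₀ F hEos η₁ hη₁ hη₁lt a₀ θ₀ u₀ ha hθ hu ha0 hθ0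
  obtain ⟨σ₁, hσ₁, H1⟩ := hIso a₀ θ₀ u₀ ha hθ hu ha0 hθ0
  obtain ⟨σ₂, hσ₂, H2⟩ := hStr a₀ θ₀ u₀ ha hθ hu ha0 hθ0
  refine ⟨min σ₁ σ₂, lt_min hσ₁ hσ₂, ?_⟩
  intro σ hσ hσlt T ρ θ u hE Φ h0 hT τ hτ hτT φ hφ _hφ0 _hsupp c hc η δ hη hδ
  have hσ1 : σ < σ₁ := lt_of_lt_of_le hσlt (min_le_left _ _)
  have hσ2 : σ < σ₂ := lt_of_lt_of_le hσlt (min_le_right _ _)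
  have hδ2 : 0 < δ / 2 := by positivity
  -- the weight bound on `[0,τ] × 𝕋³`: `|φ (2/5)(Z−1)| ≤ M₀ (2/5) η₁ K_Z ≤ M`
  obtain ⟨M₀, hM₀⟩ := hφ.exists_norm_le_of_isCompact isCompact_Icc (Set.subset_univ (Set.Icc (0 : ℝ) τ))
  obtain ⟨KZ, hKZ0, hKZ⟩ := hEos.exists_bound (mul_pos hc (pow_pos hσ 3)) hη₁lt
  set M : ℝ := max (M₀ * (2 / 5 * (η₁ * KZ))) 0 with hMdef
  have hM0 : 0 ≤ M := le_max_right _ _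
  -- strain tightness at `δ/2`, isotropy at level `η c / ((M + 1) K)`, `δ/2`
  obtain ⟨K, hK, r₂, hr₂, H2'⟩ := H2 σ hσ hσ2 T ρ θ u hE Φ h0 hT τ hτ hτT c η₁ hc (δ / 2) hδ2
  have hη' : 0 < η * c / ((M + 1) * K) := by positivity
  obtain ⟨r₁, hr₁, H1'⟩ :=
    H1 σ hσ hσ1 T ρ θ u hE Φ h0 hT τ hτ hτT c η₁ hc (η * c / ((M + 1) * K)) (δ / 2) hη' hδ2
  refine ⟨min r₁ r₂, lt_min hr₁ hr₂, ?_⟩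
  intro r hr hrlt
  obtain ⟨N₁, HN1⟩ := H1' r hr (lt_of_lt_of_le hrlt (min_le_left _ _))
  obtain ⟨N₂, HN2⟩ := H2' r hr (lt_of_lt_of_le hrlt (min_le_right _ _))
  refine ⟨max N₁ N₂, fun N hN => ?_⟩
  have E1 := HN1 N ((le_max_left _ _).trans hN)
  have E2 := HN2 N ((le_max_right _ _).trans hN)
  -- the weight bound on the regular event
  have hM : ∀ z : Phase N, Regular σ r τ c η₁ (Φ N) z → ∀ s ∈ Set.Icc (0 : ℝ) τ, ∀ x,
      |φ s x * (2 / 5 * (hsCompressibility (rhoC r ((Φ N).flow s z) x * σ ^ 3) - 1))| ≤ M := by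
    intro z hz s hs x
    refine le_trans ?_ (le_max_left _ _)
    rw [abs_mul]
    refine mul_le_mul ?_ ?_ (abs_nonneg _) ((norm_nonneg _).trans (hM₀ s hs x))
    · rw [← Real.norm_eq_abs]; exact hM₀ s hs x
    · rw [abs_mul, abs_of_pos (by norm_num : (0 : ℝ) < 2 / 5)]
      exact mul_le_mul_of_nonneg_left (hKZ _ (hz.rhoC_sigma_mem hσ hs x)).2 (by norm_num)
  -- event inclusion: off both exceptional events the deterministic core gives `T₁weighted ≥ -η`
  have hsub : {z | Regular σ r τ c η₁ (Φ N) z ∧ T₁weighted σ r τ φ (Φ N) z < -η} ⊆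
      {z | Regular σ r τ c η₁ (Φ N) z ∧
          η * c / ((M + 1) * K) * r < ∫ s in Set.Icc (0 : ℝ) τ, ∫ x : T3,
            ∑ k : Fin 3, ∑ l : Fin 3, |devC r ((Φ N).flow s z) x k l|} ∪
        {z | Regular σ r τ c η₁ (Φ N) z ∧
          ∃ s ∈ Set.Icc (0 : ℝ) τ, ∃ x : T3, ∃ k l : Fin 3,
            K < r * |pD k (fun y => uC r ((Φ N).flow s z) y l) x|} := by
    rintro z ⟨hReg, hT⟩
    rw [T₁weighted_eq_T₁] at hT
    by_contra hcon
    simp only [Set.mem_union, Set.mem_setOf_eq, not_or, not_and, not_lt, not_exists] at hcon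
    obtain ⟨hA, hB⟩ := hcon
    have hA' := hA hReg
    have hB' : ∀ s ∈ Set.Icc (0 : ℝ) τ, ∀ x, ∀ k l : Fin 3,
        r * |pD k (fun y => uC r ((Φ N).flow s z) y l) x| ≤ K := fun s hs x k l => hB hReg s hs x k l
    have hcore := psvK_abs_T₁_le hr hc hτ.le hReg (hM z hReg) hB'
    have hW : 0 ≤ M * K / (c * r) := by positivity
    have h1 := hcore.trans (mul_le_mul_of_nonneg_left hA' hW)
    have h2 : M * K / (c * r) * (η * c / ((M + 1) * K) * r) = η * (M / (M + 1)) := by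
      field_simp
    have h3 : η * (M / (M + 1)) < η := by
      have : M / (M + 1) < 1 := by rw [div_lt_one (by positivity)]; linarith
      nlinarith
    rw [h2] at h1
    have h4 := neg_abs_le (T₁ σ r τ
      (fun s x => φ s x * (2 / 5 * (hsCompressibility (rhoC r ((Φ N).flow s z) x * σ ^ 3) - 1))) (Φ N) z)
    linarith
  calc localGibbsLaw σ a₀ u₀ θ₀ N (Φ N) {z | Regular σ r τ c η₁ (Φ N) z ∧ T₁weighted σ r τ φ (Φ N) z < -η}
      ≤ localGibbsLaw σ a₀ u₀ θ₀ N (Φ N)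
          ({z | Regular σ r τ c η₁ (Φ N) z ∧
              η * c / ((M + 1) * K) * r < ∫ s in Set.Icc (0 : ℝ) τ, ∫ x : T3,
                ∑ k : Fin 3, ∑ l : Fin 3, |devC r ((Φ N).flow s z) x k l|} ∪
            {z | Regular σ r τ c η₁ (Φ N) z ∧
              ∃ s ∈ Set.Icc (0 : ℝ) τ, ∃ x : T3, ∃ k l : Fin 3,
                K < r * |pD k (fun y => uC r ((Φ N).flow s z) y l) x|}) := measure_mono hsub
    _ ≤ _ := measure_union_le _ _
    _ ≤ ENNReal.ofReal (δ / 2) + ENNReal.ofReal (δ / 2) := add_le_add E1 E2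
    _ = ENNReal.ofReal δ := by rw [← ENNReal.ofReal_add hδ2.le hδ2.le, add_halves]

/-- **P2′ from W′ and the weighted kinetic passivity (pre-shock)** — twin of the landed `passivityCollisional_of_enskog` with its classical third input discharged by `collisionalWorkIntegrable_holds`: W′ = the text of `CollisionalWorkEnskogLaw` (Enskog law for the strain-weighted momentum-transfer marks) with `τ < T →` inserted, inlined; event inclusion `setOf_T₂_lt_subset`, union bound. -/
theorem passivityCollisional_of_enskog_preShock :
  (∀ (η₀ : ℝ) (F : ℝ → ℝ), EosBand η₀ F → ∀ η₁ : ℝ, 0 < η₁ → η₁ < η₀ → ∀ (a₀ θ₀ : T3 → ℝ) (u₀ : T3 → V3), Continuous a₀ → Continuous θ₀ → Continuous u₀ → (∀ x, 0 < a₀ x) → (∀ x, 0 < θ₀ x) → ∃ σ₀ : ℝ, 0 < σ₀ ∧ ∀ σ : ℝ, 0 < σ → σ < σ₀ → ∀ (T : ℝ) (ρ θ : ℝ → T3 → ℝ) (u : ℝ → T3 → V3), IsHardSphereEulerSolution σ T ρ u θ → ∀ Φ : (N : ℕ) → Flow σ N, TendstoHydroFieldsAt (fun N => localGibbsLaw σ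 a₀ u₀ θ₀ N (Φ N)) Φ ρ u θ 0 → 0 < T → ∀ τ : ℝ, 0 < τ → τ < T → ∀ φ : ℝ → T3 → ℝ, Literature.Analysis.FunctionSpaces.Torus.IsSmoothSpaceTimeOn Set.univ φ → (∀ s x, 0 ≤ φ s x) → (∃ τ' : ℝ, τ' < τ ∧ ∀ s, τ' ≤ s → ∀ x, φ s x = 0) → ∀ c : ℝ, 0 < c → ∀ η δ : ℝ, 0 < η → 0 < δ → ∃ r₀ : ℝ, 0 < r₀ ∧ ∀ r : ℝ, 0 < r → r < r₀ → ∃ N₀ : ℕ, ∀ N : ℕ, N₀ ≤ N → localGibbsLaw σ a₀ u₀ θ₀ N (Φ N) {z | Regular σ r τ c η₁ (Φ N) z ∧ η < |T₂coll σ r τ φ (Φ N) z - T₂enskog σ r τ φ (Φ N) z|} ≤ ENNReal.ofReal δ) → (∀ (η₀ : ℝ) (F : ℝ → ℝ), EosBand η₀ F → ∀ η₁ : ℝ, 0 < η₁ → η₁ < η₀ → ∀ (a₀ θ₀ : T3 → ℝ) (u₀ : T3 → V3), Continuous a₀ → Continuous θ₀ → Continuous u₀ → (∀ x, 0 < a₀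 x) → (∀ x, 0 < θ₀ x) → ∃ σ₀ : ℝ, 0 < σ₀ ∧ ∀ σ : ℝ, 0 < σ → σ < σ₀ → ∀ (T : ℝ) (ρ θ : ℝ → T3 → ℝ) (u : ℝ → T3 → V3), IsHardSphereEulerSolution σ T ρ u θ → ∀ Φ : (N : ℕ) → Flow σ N, TendstoHydroFieldsAt (fun N => localGibbsLaw σ a₀ u₀ θ₀ N (Φ N)) Φ ρ u θ 0 → 0 < T → ∀ τ : ℝ, 0 < τ → τ < T → ∀ φ : ℝ → T3 → ℝ, Literature.Analysis.FunctionSpaces.Torus.IsSmoothSpaceTimeOn Set.univ φ → (∀ s x, 0 ≤ φ s x) → (∃ τ' : ℝ, τ' < τ ∧ ∀ s, τ' ≤ s → ∀ x, φ s x = 0) → ∀ c : ℝ, 0 < c → ∀ η δ : ℝ, 0 < η → 0 < δ → ∃ r₀ : ℝ, 0 < r₀ ∧ ∀ r : ℝ, 0 < r → r < r₀ → ∃ N₀ : ℕ, ∀ N : ℕ, N₀ ≤ N → localGibbsLaw σ a₀ u₀ θ₀ N (Φ N) {z | Regular σ r τ c η₁ (Φ N) z ∧ T₁weighted σ r τ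 φ (Φ N) z < -η} ≤ ENNReal.ofReal δ) →
  ∀ (η₀ : ℝ) (F : ℝ → ℝ), EosBand η₀ F → ∀ η₁ : ℝ, 0 < η₁ → η₁ < η₀ →
  ∀ (a₀ θ₀ : T3 → ℝ) (u₀ : T3 → V3), Continuous a₀ → Continuous θ₀ → Continuous u₀ →
    (∀ x, 0 < a₀ x) → (∀ x, 0 < θ₀ x) → ∃ σ₀ : ℝ, 0 < σ₀ ∧ ∀ σ : ℝ, 0 < σ → σ < σ₀ →
    ∀ (T : ℝ) (ρ θ : ℝ → T3 → ℝ) (u : ℝ → T3 → V3), IsHardSphereEulerSolution σ T ρ u θ →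
    ∀ Φ : (N : ℕ) → Flow σ N,
    TendstoHydroFieldsAt (fun N => localGibbsLaw σ a₀ u₀ θ₀ N (Φ N)) Φ ρ u θ 0 → 0 < T →
    ∀ τ : ℝ, 0 < τ → τ < T → ∀ φ : ℝ → T3 → ℝ, Literature.Analysis.FunctionSpaces.Torus.IsSmoothSpaceTimeOn Set.univ φ →
    (∀ s x, 0 ≤ φ s x) → (∃ τ' : ℝ, τ' < τ ∧ ∀ s, τ' ≤ s → ∀ x, φ s x = 0) →
    ∀ c : ℝ, 0 < c →
    ∀ η δ : ℝ, 0 < η → 0 < δ → ∃ r₀ : ℝ, 0 < r₀ ∧ ∀ r : ℝ, 0 < r → r < r₀ → ∃ N₀ : ℕ, ∀ N : ℕ, N₀ ≤ N →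
      localGibbsLaw σ a₀ u₀ θ₀ N (Φ N)
          {z | Regular σ r τ c η₁ (Φ N) z ∧ T₂ σ r τ φ (Φ N) z < -η}
        ≤ ENNReal.ofReal δ := by
  intro hW hK η₀ F hE η₁ hη₁ hη₁lt a₀ θ₀ u₀ ha hθ hu ha0 hθ0
  obtain ⟨σW, hσW, HW⟩ := hW η₀ F hE η₁ hη₁ hη₁lt a₀ θ₀ u₀ ha hθ hu ha0 hθ0
  obtain ⟨σK, hσK, HK⟩ := hK η₀ F hE η₁ hη₁ hη₁lt a₀ θ₀ u₀ ha hθ hu ha0 hθ0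
  refine ⟨min σW σK, lt_min hσW hσK, ?_⟩
  intro σ hσ hσlt T ρ θ u hEu Φ h0 hT τ hτ hτT φ hφ hφ0 hsupp c hc η δ hη hδ
  have hη2 : 0 < η / 2 := by positivity
  have hδ2 : 0 < δ / 2 := by positivity
  obtain ⟨rW, hrW, HrW⟩ := HW σ hσ (lt_of_lt_of_le hσlt (min_le_left _ _)) T ρ θ u hEu Φ h0 hT τ hτ hτT φ hφ
    hφ0 hsupp c hc (η / 2) (δ / 2) hη2 hδ2
  obtain ⟨rK, hrK, HrK⟩ := HK σ hσ (lt_of_lt_of_le hσlt (min_le_right _ _)) T ρ θ u hEu Φ h0 hT τ hτ hτT φ hφ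
    hφ0 hsupp c hc (η / 2) (δ / 2) hη2 hδ2
  refine ⟨min rW rK, lt_min hrW hrK, fun r hr hrlt => ?_⟩
  obtain ⟨NW, HNW⟩ := HrW r hr (lt_of_lt_of_le hrlt (min_le_left _ _))
  obtain ⟨NK, HNK⟩ := HrK r hr (lt_of_lt_of_le hrlt (min_le_right _ _))
  refine ⟨max NW NK, fun N hN => ?_⟩
  have hW' := HNW N (le_trans (le_max_left _ _) hN)
  have hK' := HNK N (le_trans (le_max_right _ _) hN)
  have hsub := setOf_T₂_lt_subset (η := η) (fun z hz =>
    collisionalWorkIntegrable_holds η₀ F hE η₁ c σ r τ hη₁lt hc hσ hr hτ φ hφ N (Φ N) z hz)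
  calc localGibbsLaw σ a₀ u₀ θ₀ N (Φ N) {z | Regular σ r τ c η₁ (Φ N) z ∧ T₂ σ r τ φ (Φ N) z < -η}
      ≤ localGibbsLaw σ a₀ u₀ θ₀ N (Φ N)
          ({z | Regular σ r τ c η₁ (Φ N) z ∧
              η / 2 < |T₂coll σ r τ φ (Φ N) z - T₂enskog σ r τ φ (Φ N) z|} ∪
            {z | Regular σ r τ c η₁ (Φ N) z ∧ T₁weighted σ r τ φ (Φ N) z < -(η / 2)}) :=
        measure_mono hsub
    _ ≤ localGibbsLaw σ a₀ u₀ θ₀ N (Φ N)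
          {z | Regular σ r τ c η₁ (Φ N) z ∧ η / 2 < |T₂coll σ r τ φ (Φ N) z - T₂enskog σ r τ φ (Φ N) z|} +
        localGibbsLaw σ a₀ u₀ θ₀ N (Φ N)
          {z | Regular σ r τ c η₁ (Φ N) z ∧ T₁weighted σ r τ φ (Φ N) z < -(η / 2)} :=
        measure_union_le _ _
    _ ≤ ENNReal.ofReal (δ / 2) + ENNReal.ofReal (δ / 2) := add_le_add hW' hK'
    _ = ENNReal.ofReal δ := by
        rw [← ENNReal.ofReal_add hδ2.le hδ2.le]
        congr 1
        ring

/-- **P3′ from Cubic′, ThermalStrain′ and CollisionalHeat′** — the pre-shock twin of the landed `passivityThermal_of_closure` (weak cubic heat-flux closure at rate `r`, thermal strain tightness at rate `1/r`, collisional heat law, each asserted only for `τ < T`; core `psvT_abs_T₃kin_le`, arithmetic `psvT_rate_arith`). -/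
theorem passivityThermal_of_closure_preShock :
  (∀ (a₀ θ₀ : T3 → ℝ) (u₀ : T3 → V3), Continuous a₀ → Continuous θ₀ → Continuous u₀ → (∀ x, 0 < a₀ x) → (∀ x, 0 < θ₀ x) → ∃ σ₀ : ℝ, 0 < σ₀ ∧ ∀ σ : ℝ, 0 < σ → σ < σ₀ → ∀ (T : ℝ) (ρ θ : ℝ → T3 → ℝ) (u : ℝ → T3 → V3), IsHardSphereEulerSolution σ T ρ u θ → ∀ Φ : (N : ℕ) → Flow σ N, TendstoHydroFieldsAt (fun N => localGibbsLaw σ a₀ u₀ θ₀ N (Φ N)) Φ ρ u θ 0 → 0 < T → ∀ τ : ℝ, 0 < τ → τ < T → ∀ c η₁ : ℝ, 0 < c → ∀ η δ : ℝ, 0 < η → 0 < δ → ∃ r₀ : ℝ, 0 < r₀ ∧ ∀ r : ℝ, 0 < r → r < r₀ → ∃ N₀ : ℕ, ∀ N : ℕ, N₀ ≤ N → localGibbsLaw σ a₀ u₀ θ₀ N (Φ N) {z | Regular σ r τ c η₁ (Φ N) z ∧ η * r < ∫ s in Set.Icc (0 : ℝ) τ, ∫ x : T3, ‖qkinC r ((Φ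 N).flow s z) x‖} ≤ ENNReal.ofReal δ) → (∀ (a₀ θ₀ : T3 → ℝ) (u₀ : T3 → V3), Continuous a₀ → Continuous θ₀ → Continuous u₀ → (∀ x, 0 < a₀ x) → (∀ x, 0 < θ₀ x) → ∃ σ₀ : ℝ, 0 < σ₀ ∧ ∀ σ : ℝ, 0 < σ → σ < σ₀ → ∀ (T : ℝ) (ρ θ : ℝ → T3 → ℝ) (u : ℝ → T3 → V3), IsHardSphereEulerSolution σ T ρ u θ → ∀ Φ : (N : ℕ) → Flow σ N, TendstoHydroFieldsAt (fun N => localGibbsLaw σ a₀ u₀ θ₀ N (Φ N)) Φ ρ u θ 0 → 0 < T → ∀ τ : ℝ, 0 < τ → τ < T → ∀ c η₁ : ℝ, 0 < c → ∀ δ : ℝ, 0 < δ → ∃ K : ℝ, 0 < K ∧ ∃ r₀ : ℝ, 0 < r₀ ∧ ∀ r : ℝ, 0 < r → r < r₀ → ∃ N₀ : ℕ, ∀ N : ℕ, N₀ ≤ N → localGibbsLaw σ a₀ u₀ θ₀ N (Φ N) {z | Regular σ r τ c η₁ (Φ N) z ∧ ∃ s ∈ Set.Icc (0 : ℝ) τ,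 ∃ x : T3, ∃ k : Fin 3, K < r * |pD k (fun y => thetaC r ((Φ N).flow s z) y) x|} ≤ ENNReal.ofReal δ) → (∀ (a₀ θ₀ : T3 → ℝ) (u₀ : T3 → V3), Continuous a₀ → Continuous θ₀ → Continuous u₀ → (∀ x, 0 < a₀ x) → (∀ x, 0 < θ₀ x) → ∃ σ₀ : ℝ, 0 < σ₀ ∧ ∀ σ : ℝ, 0 < σ → σ < σ₀ → ∀ (T : ℝ) (ρ θ : ℝ → T3 → ℝ) (u : ℝ → T3 → V3), IsHardSphereEulerSolution σ T ρ u θ → ∀ Φ : (N : ℕ) → Flow σ N, TendstoHydroFieldsAt (fun N => localGibbsLaw σ a₀ u₀ θ₀ N (Φ N)) Φ ρ u θ 0 → 0 < T → ∀ τ : ℝ, 0 < τ → τ < T → ∀ φ : ℝ → T3 → ℝ, Literature.Analysis.FunctionSpaces.Torus.IsSmoothSpaceTimeOn Set.univ φ → (∀ s x, 0 ≤ φ s x) → (∃ τ' : ℝ, τ' < τ ∧ ∀ s, τ' ≤ s → ∀ x, φ s x = 0) → ∀ c η₁ : ℝ, 0 < c → ∀ η δ : ℝ, 0 < η → 0 <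 δ → ∃ r₀ : ℝ, 0 < r₀ ∧ ∀ r : ℝ, 0 < r → r < r₀ → ∃ N₀ : ℕ, ∀ N : ℕ, N₀ ≤ N → localGibbsLaw σ a₀ u₀ θ₀ N (Φ N) {z | Regular σ r τ c η₁ (Φ N) z ∧ η < |T₃coll σ r τ φ (Φ N) z|} ≤ ENNReal.ofReal δ) → ∀ (a₀ θ₀ : T3 → ℝ) (u₀ : T3 → V3), Continuous a₀ → Continuous θ₀ → Continuous u₀ → (∀ x, 0 < a₀ x) → (∀ x, 0 < θ₀ x) → ∃ σ₀ : ℝ, 0 < σ₀ ∧ ∀ σ : ℝ, 0 < σ → σ < σ₀ → ∀ (T : ℝ) (ρ θ : ℝ → T3 → ℝ) (u : ℝ → T3 → V3), IsHardSphereEulerSolution σ T ρ u θ → ∀ Φ : (N : ℕ) → Flow σ N, TendstoHydroFieldsAt (fun N => localGibbsLaw σ a₀ u₀ θ₀ N (Φ N)) Φ ρ u θ 0 → 0 < T → ∀ τ : ℝ, 0 < τ → τ < T → ∀ φ : ℝ → T3 → ℝ, Literature.Analysis.FunctionSpaces.Torus.IsSmoothSpaceTimeOn Set.univ φ → (∀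 s x, 0 ≤ φ s x) → (∃ τ' : ℝ, τ' < τ ∧ ∀ s, τ' ≤ s → ∀ x, φ s x = 0) → ∀ c η₁ : ℝ, 0 < c → ∀ η δ : ℝ, 0 < η → 0 < δ → ∃ r₀ : ℝ, 0 < r₀ ∧ ∀ r : ℝ, 0 < r → r < r₀ → ∃ N₀ : ℕ, ∀ N : ℕ, N₀ ≤ N → localGibbsLaw σ a₀ u₀ θ₀ N (Φ N) {z | Regular σ r τ c η₁ (Φ N) z ∧ T₃ σ r τ φ (Φ N) z < -η} ≤ ENNReal.ofReal δ := by
  intro hQ hΘ hC a₀ θ₀ u₀ ha hθ hu ha0 hθ0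
  obtain ⟨σ₁, hσ₁, H1⟩ := hQ a₀ θ₀ u₀ ha hθ hu ha0 hθ0
  obtain ⟨σ₂, hσ₂, H2⟩ := hΘ a₀ θ₀ u₀ ha hθ hu ha0 hθ0
  obtain ⟨σ₃, hσ₃, H3⟩ := hC a₀ θ₀ u₀ ha hθ hu ha0 hθ0
  refine ⟨min (min σ₁ σ₂) σ₃, lt_min (lt_min hσ₁ hσ₂) hσ₃, ?_⟩
  intro σ hσ hσlt T ρ θ u hE Φ h0 hT τ hτ hτT φ hφ hφ0 hsupp c η₁ hc η δ hη hδ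
  have hσ1 : σ < σ₁ := lt_of_lt_of_le hσlt ((min_le_left _ _).trans (min_le_left _ _))
  have hσ2 : σ < σ₂ := lt_of_lt_of_le hσlt ((min_le_left _ _).trans (min_le_right _ _))
  have hσ3 : σ < σ₃ := lt_of_lt_of_le hσlt (min_le_right _ _)
  have hδ3 : 0 < δ / 3 := by positivity
  have hη2 : 0 < η / 2 := by positivity
  -- weight bounds on `[0, τ] × 𝕋³`
  obtain ⟨M, M', hM0, hM'0, hM, hM'⟩ := psvT_phi_bounds hφ τ
  -- thermal strain tightness at `δ/3`
  obtain ⟨K, hK, r₂, hr₂, H2'⟩ := H2 σ hσ hσ2 T ρ θ u hE Φ h0 hT τ hτ hτT c η₁ hc (δ / 3) hδ3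
  -- cubic heat-flux rate at level `η / (6 (A + 1))`, `A = M'/c + MK/c²`, and `δ/3`
  have hη' : 0 < η / (6 * (M' / c + M * K / c ^ 2 + 1)) := by positivity
  obtain ⟨r₁, hr₁, H1'⟩ :=
    H1 σ hσ hσ1 T ρ θ u hE Φ h0 hT τ hτ hτT c η₁ hc (η / (6 * (M' / c + M * K / c ^ 2 + 1))) (δ / 3) hη' hδ3
  -- collisional heat law at `(η/2, δ/3)`
  obtain ⟨r₃, hr₃, H3'⟩ := H3 σ hσ hσ3 T ρ θ u hE Φ h0 hT τ hτ hτT φ hφ hφ0 hsupp c η₁ hc (η / 2) (δ / 3) hη2 hδ3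
  refine ⟨min (min (min r₁ r₂) r₃) 1, lt_min (lt_min (lt_min hr₁ hr₂) hr₃) one_pos, ?_⟩
  intro r hr hrlt
  have hr1 : r < r₁ := lt_of_lt_of_le hrlt ((min_le_left _ _).trans ((min_le_left _ _).trans (min_le_left _ _)))
  have hr2 : r < r₂ := lt_of_lt_of_le hrlt ((min_le_left _ _).trans ((min_le_left _ _).trans (min_le_right _ _)))
  have hr3 : r < r₃ := lt_of_lt_of_le hrlt ((min_le_left _ _).trans (min_le_right _ _))
  have hr1' : r ≤ 1 := (lt_of_lt_of_le hrlt (min_le_right _ _)).le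
  obtain ⟨N₁, HN1⟩ := H1' r hr hr1
  obtain ⟨N₂, HN2⟩ := H2' r hr hr2
  obtain ⟨N₃, HN3⟩ := H3' r hr hr3
  refine ⟨max (max N₁ N₂) N₃, fun N hN => ?_⟩
  have E1 := HN1 N (((le_max_left _ _).trans (le_max_left _ _)).trans hN)
  have E2 := HN2 N (((le_max_right _ _).trans (le_max_left _ _)).trans hN)
  have E3 := HN3 N ((le_max_right _ _).trans hN)
  -- event inclusion: off the three exceptional events the deterministic core gives `T₃ > -η`
  have hsub : {z | Regular σ r τ c η₁ (Φ N) z ∧ T₃ σ r τ φ (Φ N) z < -η} ⊆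
      ({z | Regular σ r τ c η₁ (Φ N) z ∧
          η / (6 * (M' / c + M * K / c ^ 2 + 1)) * r <
            ∫ s in Set.Icc (0 : ℝ) τ, ∫ x : T3, ‖qkinC r ((Φ N).flow s z) x‖} ∪
        {z | Regular σ r τ c η₁ (Φ N) z ∧ ∃ s ∈ Set.Icc (0 : ℝ) τ, ∃ x : T3, ∃ k : Fin 3,
          K < r * |pD k (fun y => thetaC r ((Φ N).flow s z) y) x|}) ∪
        {z | Regular σ r τ c η₁ (Φ N) z ∧ η / 2 < |T₃coll σ r τ φ (Φ N) z|} := by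
    rintro z ⟨hReg, hT3⟩
    by_contra hcon
    have hA' : ¬(η / (6 * (M' / c + M * K / c ^ 2 + 1)) * r <
        ∫ s in Set.Icc (0 : ℝ) τ, ∫ x : T3, ‖qkinC r ((Φ N).flow s z) x‖) :=
      fun h => hcon (Or.inl (Or.inl ⟨hReg, h⟩))
    have hB' : ¬(∃ s ∈ Set.Icc (0 : ℝ) τ, ∃ x : T3, ∃ k : Fin 3,
        K < r * |pD k (fun y => thetaC r ((Φ N).flow s z) y) x|) :=
      fun h => hcon (Or.inl (Or.inr ⟨hReg, h⟩))
    have hC' : ¬(η / 2 < |T₃coll σ r τ φ (Φ N) z|) := fun h => hcon (Or.inr ⟨hReg, h⟩)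
    rw [not_lt] at hA' hC'
    have hKle : ∀ s ∈ Set.Icc (0 : ℝ) τ, ∀ x, ∀ k : Fin 3,
        r * |pD k (fun y => thetaC r ((Φ N).flow s z) y) x| ≤ K :=
      fun s hs x k => not_lt.1 fun h => hB' ⟨s, hs, x, k, h⟩
    have hcore := psvT_abs_T₃kin_le hr hc hτ.le hReg hφ hM hM' hKle
    have hW0 : 0 ≤ 3 * (M' / c + M * K / (r * c ^ 2)) := by positivity
    have h1 : |T₃kin σ r τ φ (Φ N) z| < η / 2 :=
      (hcore.trans (mul_le_mul_of_nonneg_left hA' hW0)).trans_lt (psvT_rate_arith hM0 hM'0 hK.le hc hr hr1' hη)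
    have h2 := neg_abs_le (T₃kin σ r τ φ (Φ N) z)
    have h3 := neg_abs_le (T₃coll σ r τ φ (Φ N) z)
    have h4 : T₃ σ r τ φ (Φ N) z = T₃kin σ r τ φ (Φ N) z + T₃coll σ r τ φ (Φ N) z := rfl
    linarith
  calc localGibbsLaw σ a₀ u₀ θ₀ N (Φ N) {z | Regular σ r τ c η₁ (Φ N) z ∧ T₃ σ r τ φ (Φ N) z < -η}
      ≤ localGibbsLaw σ a₀ u₀ θ₀ N (Φ N)
          (({z | Regular σ r τ c η₁ (Φ N) z ∧
              η / (6 * (M' / c + M * K / c ^ 2 + 1)) * r <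
                ∫ s in Set.Icc (0 : ℝ) τ, ∫ x : T3, ‖qkinC r ((Φ N).flow s z) x‖} ∪
            {z | Regular σ r τ c η₁ (Φ N) z ∧ ∃ s ∈ Set.Icc (0 : ℝ) τ, ∃ x : T3, ∃ k : Fin 3,
              K < r * |pD k (fun y => thetaC r ((Φ N).flow s z) y) x|}) ∪
            {z | Regular σ r τ c η₁ (Φ N) z ∧ η / 2 < |T₃coll σ r τ φ (Φ N) z|}) := measure_mono hsub
    _ ≤ localGibbsLaw σ a₀ u₀ θ₀ N (Φ N)
          ({z | Regular σ r τ c η₁ (Φ N) z ∧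
              η / (6 * (M' / c + M * K / c ^ 2 + 1)) * r <
                ∫ s in Set.Icc (0 : ℝ) τ, ∫ x : T3, ‖qkinC r ((Φ N).flow s z) x‖} ∪
            {z | Regular σ r τ c η₁ (Φ N) z ∧ ∃ s ∈ Set.Icc (0 : ℝ) τ, ∃ x : T3, ∃ k : Fin 3,
              K < r * |pD k (fun y => thetaC r ((Φ N).flow s z) y) x|}) +
        localGibbsLaw σ a₀ u₀ θ₀ N (Φ N)
          {z | Regular σ r τ c η₁ (Φ N) z ∧ η / 2 < |T₃coll σ r τ φ (Φ N) z|} := measure_union_le _ _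
    _ ≤ (ENNReal.ofReal (δ / 3) + ENNReal.ofReal (δ / 3)) + ENNReal.ofReal (δ / 3) :=
        add_le_add ((measure_union_le _ _).trans (add_le_add E1 E2)) E3
    _ = ENNReal.ofReal δ := by
        rw [← ENNReal.ofReal_add hδ3.le hδ3.le, ← ENNReal.ofReal_add (by positivity) hδ3.le, add_thirds]

end Summit.AtomisticToContinuum.HydrodynamicLimit.Theorems.LocalSecondLawLedger

end
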